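import Literature.Geometry.Symplectic.JPlanePencilUniversality
import Literature.Geometry.Symplectic.JPlanePencilFamilyOverlap
import HarnessLib

/-!
# Reduction of Wendl's Prop. 2.53 (`m = 1`, homotopy 4-spheres) to its analytic existence half

Support theorem (no named facts, D-0026) for
`Literature.Geometry.Symplectic.jPlanePencil_localFamily_homotopySphere`
(`JPlanePencilLocalFamily.lean`; C. Wendl, *Holomorphic Curves in Low Dimensions* (2018),
Prop. 2.53 with `m = 1`).

`jPlanePencil_localFamily_homotopySphere_of_compactifiedFamily`: the fact follows from the
EXISTENCE, about every member `u₀`, of a local family `Floc` of members with the regularity that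
Wendl's proof provides — members through the nearby intercepts, jointly `C^∞` and immersive in
`(b, ξ)` (implicit function theorem for the constrained moduli space, Thm. 2.46 / Thm. 2.11, with
`c₁(N_û) = 1` on a homotopy sphere), a uniform standard end, and smoothness ACROSS the constraint
point in the blow-up coordinates `(x', w) = (1/z, w)` (the constrained family is a smooth
2-parameter family of embedded spheres of the blown-up compactification through the point `q_a`
of the exceptional sphere, in their canonical parametrisations). Given that, the four existence
conjuncts of the fact are immediate and the UNIVERSALITY conjunct (with `V = univ`, `r₀ = 0`) is
`IsPencilPlane.eq_of_localFamily` (`JPlanePencilUniversality.lean`: positivity of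
intersections and `H₂(M) = 0`, Thm. 2.49), whose two first-order hypotheses are discharged by
`IsPencilPlane.familyOverlap_of_smoothCompactification` and
`IsPencilPlane.familyOrientation_of_smoothCompactification`.

What remains between this theorem and `jPlanePencil_localFamily_homotopySphere_holds` is exactly
the hypothesis `hE` below: the Fredholm/implicit-function-theorem package for embedded
`J`-holomorphic spheres with a point constraint (Wendl Thm. 2.11, 2.44–2.46, Prop. 2.53), for
which Mathlib has no vocabulary yet (normal Cauchy–Riemann operators, elliptic regularity,
Banach manifolds of maps).

## References

* C. Wendl, *Holomorphic Curves in Low Dimensions*, LNM 2216, Springer (2018), Prop. 2.53,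
  Thm. 2.49, Thm. 2.46, Thm. 2.11, Appendix B. [Wendl2018]
-/

noncomputable section

open scoped Manifold ContDiff Topology
open Set Function Filter Metric

namespace Literature.Geometry.Symplectic

/-- **Wendl's Prop. 2.53 (`m = 1`, homotopy 4-spheres) from its analytic existence half.**
If about every member there is a local family of members, jointly smooth and immersive, with a
uniform standard end and smooth across the constraint point in the blow-up coordinates at
infinity (`famXW`), then `jPlanePencil_localFamily_homotopySphere` holds: the universality clause
is proved (`IsPencilPlane.eq_of_localFamily` with `familyOverlap_…` and `familyOrientation_…`).
[cite: Wendl2018, Prop. 2.53 with Thm. 2.49, Thm. 2.46] -/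
theorem jPlanePencil_localFamily_homotopySphere_of_compactifiedFamily
    (hE : ∀ (M : Type) [TopologicalSpace M] [T2Space M] [SecondCountableTopology M]
      [CompactSpace M] [ChartedSpace (EuclideanSpace ℝ (Fin 4)) M] [IsManifold (𝓡 4) ∞ M],
      Nonempty (ContinuousMap.HomotopyEquiv M (Metric.sphere (0 : EuclideanSpace ℝ (Fin 5)) 1)) →
      ∀ (p : M) (J : ∀ x : punctured p, TangentSpace (𝓡 4) x →L[ℝ] TangentSpace (𝓡 4) x)
        (ε' : ℝ), 0 < ε' →
      Metric.closedBall (extChartAt (𝓡 4) p p) ε' ⊆ (extChartAt (𝓡 4) p).target →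
      (∀ (x : punctured p) (v : TangentSpace (𝓡 4) x), J x (J x v) = -v) →
      (∀ x₀ : punctured p, ContMDiffAt (𝓡 4)
        𝓘(ℝ, EuclideanSpace ℝ (Fin 4) →L[ℝ] EuclideanSpace ℝ (Fin 4)) ∞
        (inTangentCoordinates (𝓡 4) (𝓡 4) (id : punctured p → punctured p) id
          (fun x => J x) x₀) x₀) →
      (∀ x : punctured p, InPuncturedChartBall p ε' x →
        ∀ (v : TangentSpace (𝓡 4) x) (c : EuclideanSpace ℝ (Fin 4)),
          inner ℝ (fderiv ℝ inversion (extChartAt (𝓡 4) p x.1 - extChartAt (𝓡 4) p p)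
            (mfderiv (𝓡 4) 𝓘(ℝ, EuclideanSpace ℝ (Fin 4))
              (fun z : punctured p => extChartAt (𝓡 4) p z.1) x (J x v))) c
          = stdSymplecticForm (fderiv ℝ inversion (extChartAt (𝓡 4) p x.1 - extChartAt (𝓡 4) p p)
            (mfderiv (𝓡 4) 𝓘(ℝ, EuclideanSpace ℝ (Fin 4))
              (fun z : punctured p => extChartAt (𝓡 4) p z.1) x v)) c) →
      ∀ (u₀ : ℂ → punctured p) (b₀ : ℂ), IsPencilPlane J u₀ b₀ →
        ∃ δ : ℝ, 0 < δ ∧ ∃ Floc : ℂ → ℂ → punctured p, Floc b₀ = u₀ ∧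
          (∀ b ∈ Metric.ball b₀ δ, IsPencilPlane J (Floc b) b) ∧
          ContMDiffOn 𝓘(ℝ, ℂ × ℂ) (𝓡 4) ∞ (fun q : ℂ × ℂ => Floc q.1 q.2)
            ((Metric.ball b₀ δ) ×ˢ (univ : Set ℂ)) ∧
          (∀ q : ℂ × ℂ, q.1 ∈ Metric.ball b₀ δ →
            Function.Injective (mfderiv 𝓘(ℝ, ℂ × ℂ) (𝓡 4) (fun q : ℂ × ℂ => Floc q.1 q.2) q)) ∧
          ∃ rI : ℝ, 0 < rI ∧
            (∀ b ∈ Metric.ball b₀ δ, ∀ η : ℂ, η ≠ 0 → ‖η‖ < rI →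
              InPuncturedChartBall p ε' (Floc b η⁻¹) ∧ 1 < ‖(pencilCoord p (Floc b η⁻¹)).1‖) ∧
            ContDiffOn ℝ ∞ (famXW p Floc) (Metric.ball b₀ δ ×ˢ Metric.ball 0 rI)) :
    jPlanePencil_localFamily_homotopySphere := by
  intro M _ _ _ _ _ _ hM p J ε' hε' hεt hJ2 hJs hJstd u₀ b₀ hu₀
  obtain ⟨δ, hδ, Floc, hF0, hmem, hsmooth, himm, rI, hrI, hU, hSinf⟩ :=
    hE M hM p J ε' hε' hεt hJ2 hJs hJstd u₀ b₀ hu₀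
  have hhalf : ball b₀ (δ / 2) ⊆ ball b₀ δ := ball_subset_ball (by linarith)
  refine ⟨δ / 2, half_pos hδ, Floc, hF0, fun b hb => hmem b (hhalf hb),
    hsmooth.mono (prod_mono hhalf Subset.rfl), fun q hq => himm q (hhalf hq), 0, univ,
    isOpen_univ, fun _ => mem_univ _, ?_⟩
  intro u b hu hb _
  -- re-centre the family at `b`
  have hsubδ : ball b (δ / 2) ⊆ ball b₀ δ := fun x hx => by
    rw [mem_ball] at hx hb ⊢
    linarith [dist_triangle x b b₀]
  have hmem' : ∀ b' ∈ ball b (δ / 2), IsPencilPlane J (Floc b') b' :=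
    fun b' hb' => hmem b' (hsubδ hb')
  have hsmooth' : ContMDiffOn 𝓘(ℝ, ℂ × ℂ) (𝓡 4) ∞ (fun q : ℂ × ℂ => Floc q.1 q.2)
      (ball b (δ / 2) ×ˢ (univ : Set ℂ)) := hsmooth.mono (prod_mono hsubδ Subset.rfl)
  have himm' : ∀ q ∈ ball b (δ / 2) ×ˢ (univ : Set ℂ),
      Injective (mfderiv 𝓘(ℝ, ℂ × ℂ) (𝓡 4) (fun q : ℂ × ℂ => Floc q.1 q.2) q) :=
    fun q hq => himm q (hsubδ hq.1)
  have hU' : ∀ b' ∈ ball b (δ / 2), ∀ η : ℂ, η ≠ 0 → ‖η‖ < rI →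
      InPuncturedChartBall p ε' (Floc b' η⁻¹) ∧ 1 < ‖(pencilCoord p (Floc b' η⁻¹)).1‖ :=
    fun b' hb' => hU b' (hsubδ hb')
  have hSinf' : ContDiffOn ℝ ∞ (famXW p Floc) (ball b (δ / 2) ×ˢ ball 0 rI) :=
    hSinf.mono (prod_mono hsubδ Subset.rfl)
  have hL : IsPencilPlane J (Floc b) b := hmem' b (mem_ball_self (half_pos hδ))
  obtain ⟨r, hr, hdisc, hσ, hWr, hinjσ, hbij⟩ := hL.exists_capFst_goodDisc hε' hJstd
  obtain ⟨δG, η₁, hδG, hδGle, hη₁, hG⟩ :=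
    IsPencilPlane.familyOverlap_of_smoothCompactification (half_pos hδ) hmem' hrI hU' hSinf'
      hr hσ hWr hinjσ hbij
  obtain ⟨Rₛ, hS⟩ :=
    IsPencilPlane.familyOrientation_of_smoothCompactification hε' hJstd (half_pos hδ) hmem'
      hsmooth' hrI hU' hSinf'
  have hsubG : ball b δG ⊆ ball b (δ / 2) := ball_subset_ball hδGle
  exact IsPencilPlane.eq_of_localFamily hM hJ2 hJs hε' hεt hJstd hδG
    (fun b' hb' => hmem' b' (hsubG hb')) (hsmooth'.mono (prod_mono hsubG Subset.rfl))
    (fun q hq => himm' q ⟨hsubG hq.1, hq.2⟩) hr hdisc hσ hWr hinjσ hbij hη₁ hG hS hu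

end Literature.Geometry.Symplectic
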